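import Summits.Ventures.PercRepro.ProfilePointedParallelExtension

/-!
# PercRepro — TWO MORE AUTOMATIC REGIMES OF (Ĉ): A LOOP (unconditional), AND A POINT WHOSE EXTENSION COUNT IS AT
LEAST THE AVERAGE (modulo Theorem A) (p10, gen 23; `proofs/P10-DIRECTSUM-g23.md` §6, §8)

* A loop `ℓ` (`ρ{ℓ} = 0`) lies in no independent set, so no set and its complement are both independent: every
  bi-independent profile vanishes (`card_biIndepSets_eq_zero_of_loop`, ProfilePointedParallelExtension.lean) and every
  instance of (Ĉ) reads `0 ≤ …`: `PointedRowAt M p` for every `p`, with NO hypothesis (`pointedRowAt_of_loop`) — a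
  (Ĉ)-witness, if any, is loopless (`rk_singleton_pos_of_not_pointedRowAt`).
* Gen 13's averaged theorem `pointed_average_of_fact` — `N·(N−k−1)·P_k ≤ N·k·P_{k+1} + (N−2k−1)·Σ_q c^q_k` — gives (Ĉ)
  at `(M, p, k)` as soon as `Σ_q c^q_k ≤ N·c^p_k`, i.e. whenever the extension count of `p` is at least the average
  over the points (`pointedRow_of_sum_extCount_le`; it contains `pointedRow_of_extCount_const` of
  ProfilePointedHomogeneous.lean).  Contrapositive: (Ĉ) can fail at `(M, p, k)` only at a point whose extension count
  is strictly BELOW the average at that level (`sum_extCount_lt_of_not_pointedRow`) — the second description of the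
  over-captured regime, beside gen 13's `P_k ≤ (k+1)·c^p_k` (`pointedRow_of_le_extCount`).

Nothing here asserts (Ĉ).
-/

open scoped Matroid

namespace PercRepro.Cogirth

open Finset ThmH Skew

variable {α : Type} [DecidableEq α] {M : Matroid α} [M.Finite]

/-- **(Ĉ) AT EVERY POINT OF A MATROID WITH A LOOP** (unconditional): every bi-independent profile vanishes. -/
theorem pointedRowAt_of_loop {l : α} (hl : l ∈ gr M) (hl0 : rk M {l} = 0) (p : α) : PointedRowAt M p := by
  intro k _
  rw [card_biIndepSets_eq_zero_of_loop hl hl0 k]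
  simp

/-- **A (Ĉ)-WITNESS IS LOOPLESS** (unconditional): a failure of (Ĉ) at `(M, p)` forces every point of `M` to be a
non-loop. -/
theorem rk_singleton_pos_of_not_pointedRowAt {p : α} (h : ¬ PointedRowAt M p) {l : α} (hl : l ∈ gr M) :
    0 < rk M {l} := by
  by_contra h0
  exact h (pointedRowAt_of_loop hl (by omega) p)

/-- **(Ĉ) AT A POINT WHOSE EXTENSION COUNT IS AT LEAST THE AVERAGE** (CONDITIONAL on the named fact): if
`Σ_{q ∈ E} c^q_k ≤ N·c^p_k`, then (Ĉ) holds at `(M, p, k)` — `pointed_average_of_fact` with `Σ_q c^q_k` bounded by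
`N·c^p_k`, divided by `N`. -/
theorem pointedRow_of_sum_extCount_le (hfact : BiIndepDensityLogConcave α) (M : Matroid α) [M.Finite] {p : α}
    (hp : p ∈ gr M) (k : ℕ) (hk : 2 * k + 2 ≤ (gr M).card)
    (hle : ∑ q ∈ gr M, extCount M k q ≤ (gr M).card * extCount M k p) :
    ((gr M).card - k - 1) * (biIndepSets M k).card ≤
      k * (biIndepSets M (k + 1)).card + ((gr M).card - 2 * k - 1) * extCount M k p := by
  have h := pointed_average_of_fact hfact M k hk
  have hN : 0 < (gr M).card := card_pos.2 ⟨p, hp⟩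
  have h' : (gr M).card * (((gr M).card - k - 1) * (biIndepSets M k).card) ≤
      (gr M).card * (k * (biIndepSets M (k + 1)).card + ((gr M).card - 2 * k - 1) * extCount M k p) := by
    calc (gr M).card * (((gr M).card - k - 1) * (biIndepSets M k).card)
        = (gr M).card * ((gr M).card - k - 1) * (biIndepSets M k).card := by ring
      _ ≤ (gr M).card * k * (biIndepSets M (k + 1)).card +
            ((gr M).card - 2 * k - 1) * ∑ q ∈ gr M, extCount M k q := h
      _ ≤ (gr M).card * k * (biIndepSets M (k + 1)).card +
            ((gr M).card - 2 * k - 1) * ((gr M).card * extCount M k p) :=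
          Nat.add_le_add_left (Nat.mul_le_mul_left _ hle) _
      _ = (gr M).card * (k * (biIndepSets M (k + 1)).card +
            ((gr M).card - 2 * k - 1) * extCount M k p) := by ring
  exact Nat.le_of_mul_le_mul_left h' hN

/-- **(Ĉ) FAILS ONLY BELOW THE AVERAGE** (CONDITIONAL on the named fact): a failure of (Ĉ) at `(M, p, k)` forces
`N·c^p_k < Σ_{q ∈ E} c^q_k` — the extension count of `p` is strictly below the average over the points. -/
theorem sum_extCount_lt_of_not_pointedRow (hfact : BiIndepDensityLogConcave α) (M : Matroid α) [M.Finite] {p : α}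
    (hp : p ∈ gr M) (k : ℕ) (hk : 2 * k + 2 ≤ (gr M).card)
    (h : ¬ (((gr M).card - k - 1) * (biIndepSets M k).card ≤
      k * (biIndepSets M (k + 1)).card + ((gr M).card - 2 * k - 1) * extCount M k p)) :
    (gr M).card * extCount M k p < ∑ q ∈ gr M, extCount M k q := by
  by_contra hle
  exact h (pointedRow_of_sum_extCount_le hfact M hp k hk (by omega))

end PercRepro.Cogirth
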